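import Summits.QuantumFields.YangMills.Theorems.BalabanUVNodesN07DataDownTheRadialTower
import Summits.QuantumFields.YangMills.Theorems.BalabanUVNodesN07FineBoxShearVariation
import Literature.MathematicalPhysics.QuantumFieldTheory.BalabanImbrieJaffe1984to88.BIJ88BlockCentredWeight
import HarnessLib

/-!
# N07 [B11] (= [15] = [Balaban1985Variational]) Sect. F, road of record R0′, WIDTH-209 row (r2), FILE 14: **THE PER-RUN SUM `hrun` OF FILE 12 FOR COVER-LABELLED RUNS,
# VAL-FREE** — dag-n07-w6's crossing count ([B11] (145), `N07FinePathCrossingCount`) read on the universal cover: the run `s ↦ runBond (castSite z) μ s` needs NO `ZMod.val`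
# anchoring (`hval`, `hwrap`, `hv`), because `Lⁱ ∣ N₀ = 2L^{m+K}` for `i ≤ m + K` and the one wrapping bond of a run crosses every face

Cell `pub-ymgap`, width seat `pub-ymgap-dag-n07-w8` g6, WIDTH-209 N07 row (r2) of road R0′, CLAIM-14 ∕ INTENT-14 (cell bus; own lineage FILE 12 p634946 ✓ → FILE 14; dag-n07-w6's
FILES 7∕8∕9 CONSUMED BY NAME).  `--kind proof --supports stmt-QuantumFields-27364 --as helper` (K1⁹ per dag-lead KEY MAP v2); count-neutral; def-free.
[15] = [Balaban1985Variational] (145) p. 301, (152) p. 301; [6] = [Balaban1985RegularSpaces] (1.15) p. 78, Lemma 1 (1.25) p. 79; [I] = [Balaban1987RG1] (0.1)–(0.3) pp. 251–252;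
[I.4] = [Balaban1984PropagatorsI] (1.6)–(1.7) p. 18.

THE POINT (LOCATED-VAL-ANCHOR, cell bus, this seat g6).  FILE 12 `N07FineBoxShearVariation.fineVariation_le_of_runSums` displays, for every straight run inside an integer label box
`[LO, HI] ⊂ ℤᵈ` read on the torus through `castSite`, the axial side `Σ_{s<m} dist1 U′(runBond (castSite z) μ s) ≤ Φ_μ(m)`.  dag-n07-w6's supplier `N07FinePathCrossingCount.sum_dist1_fine_path_le`
(and its radial-tower edition `N07DataDownTheRadialTower.sum_dist1_fine_path_radialTower_le`) proves exactly this sum, but keyed on residues: `hval : ((b s)₋)_μ.val = v₀ + s`,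
`hwrap : v₀ + n + 1 ≤ N₀`, per bond `hv : val + 1 < N₀`.  A fine collar cube `□̃` whose label box contains the hyperplane `val ≡ 0 (mod N₀)` has no representative satisfying these —
yet the geometry is label-invariant: `blockOf ∘ π_j = π_{j+1} ∘ ⌊·∕L⌋` for ALL integer labels (lit `Node00.TorusCoverLevels.blockOf_coverAt`).  THIS FILE removes the anchoring:
(i) `Lⁱ ∣ N₀` for `i ≤ m + K` (lit `BIJ88BlockCentredWeight.pow_dvd_sitesPerDir`), so `Lⁱ ∣ val + 1 ⇔ (Lⁱ : ℤ) ∣ z_μ + 1` for the cover-labelled site `castSite z` (`ZMod.val_intCast`); (ii) the wrapping bond (`val + 1 = N₀`) has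
`iterBlockOf i b₋ ≠ iterBlockOf i b₊` at EVERY height `i ≤ m + K` (`val_iterBlockOf`: `(N₀ − 1) ∕ Lⁱ ≥ 1`, `0 ∕ Lⁱ = 0`), so it is dag-n07-w6 FILE 7's reach-the-top case
`dist1_fine_le_of_top` and obeys the SAME layer bound (every height admitted); (iii) the layer-cake count at an INTEGER anchor `v₀ ∈ ℤ` reduces to dag-n07-w6's `sum_le_layerCake` at
`v₀ mod Lᵏ ∈ [0, Lᵏ)`.  Result: the per-run sum for `b s := runBond (castSite z) μ s` with ONLY «both ends in the bottom window» — the `hrun` binder of FILE 12, for every run.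

WHAT IS PROVED (sorry-free; no definition; axioms standard).
* §1 ★ `dvd_val_succ_iff_dvd_label` (`Lⁱ ∣ ((castSite z) μ).val + 1 ↔ (Lⁱ : ℤ) ∣ z μ + 1`) · ★ `iterBlockOf_src_ne_tgt_of_wrap`
  (`val + 1 = N₀ ⇒ iterBlockOf i b₋ ≠ iterBlockOf i b₊`, `i ≤ m + K`) · ★★ `dist1_fine_le_layer_any` (dag-n07-w6's `dist1_fine_le_layer` WITHOUT `hv`).
* §2 ★ `sum_le_layerCake_int` (the layer-cake sum at an integer anchor `v₀ : ℤ`, predicate `(Lⁱ : ℤ) ∣ v₀ + s + 1`).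
* §3 ★★★ `sum_dist1_run_le` — for `z : ℤᵈ`, `μ`, `n`, with both ends of every `runBond (castSite z) μ s`, `s < n`, in the bottom window:
  `Σ_{s<n} dist1 (U′ (runBond (castSite z) μ s)) ≤ n·θ₀ + Σ_{i<k} (n ∕ L^{i+1} + 1)·θ_{i+1}` (`θ_i := τ_i + 7((d+2)L)²∕4·a_i + (d+1)(L−1)τ_i` for `i < k`, `θ_k := v_k`), NO `hval`∕`hwrap`;
  ★★★ `sum_dist1_run_radialTower_le` — the same at a radial-tower representative, `τ_i := (d(L−1)+1)(d−1)(L−1)·a_i` SUPPLIED (dag-n07-w6 `hint_of_radialTower`).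
* A6 `sum_dist1_run_le_one` — at `U′ = 1` every hypothesis holds with all letters `0` and the sum is `0`.
HONEST SCOPE.  Count-neutral `ZMod`∕lattice bookkeeping and by-name composition of LANDED theorems (dag-n07-w6 `N07FinePathCrossingCount.dist1_fine_le_layer` ∕ `sum_le_layerCake`,
`N07FineBondByCoarsestFace.dist1_fine_le_of_top`, `N07DataDownTheRadialTower.hint_of_radialTower`; lit `B5Eq118OneStroke.val_iterBlockOf`, `BIJ88BlockCentredWeight.pow_dvd_sitesPerDir`; this base FILE 12 `runSite_castSite`); the per-level
letters `a_i`, `τ_i`, `v_k`, the windows and the radial gauge are HYPOTHESES ∕ the consumer's; nothing of [15]∕[6]∕[I]∕[I.4] ANALYSIS asserted; `LocalLettersSplitTopStepCore(G∕R)` ∕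
`DatumGaugeSplitTopStepCore(G∕R)` ∕ `HalvingStepTop(Core)` ∕ `stub_prop8StepCoP13` NOT discharged; K0⁷ ∕ K1⁹ NOT closed; N07 NOT discharged; counts unmoved (typed 28∕28 · discharged 5∕27);
one finite 𝕋⁴ programme at fixed ε — the route closes the conditional finite-𝕋⁴ rung `BalabanLadder.UV` ONLY; the YM mass gap (Clay) is NOT proved by any of this; nothing continuum ∕ ℝ⁴ ∕ OS.
No `sorry`, no `def`, no `instance`, no `notation`.

RELATED IN THE TREE, NOT DUPLICATED (stem check 2026-08-28T13:41Z: `ls …/Theorems | rg -i 'FinePathSumLabel|PathSumLabel|LabelledRun'` = ∅): dag-n07-w6 `N07FinePathCrossingCount` (the val-keyed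
count and sum — CONSUMED, conclusions reproduced verbatim under weaker hypotheses, proofs NOT copied: the non-wrapping case IS their theorem), `N07FineBondByCoarsestFace` (per-bond chain — CONSUMED),
`N07DataDownTheRadialTower` (radial `hint` — CONSUMED); this base FILE 12 `N07FineBoxShearVariation` (the consumer of `hrun`; its `runSite_castSite` — imported).
-/

set_option autoImplicit false

noncomputable section
open scoped BigOperators Matrix.Norms.L2Operator

namespace Summit.QuantumFields.YangMills.BalabanUVNodes.N07FinePathSumLabelled

open Literature.MathematicalPhysics.QuantumFieldTheory.Balaban1983to89
open Literature.MathematicalPhysics.QuantumFieldTheory.Balaban1983to89.Node00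
open T4Continuum
open T4AxialGaugeSmallField (castSite)
open LatticeFieldCalculus (runSite runBond runSite_succ runSite_zero)
open B5Eq118OneStroke (iterBlockOf iterBlockOf_succ iterBlockOf_zero val_iterBlockOf)
open Literature.MathematicalPhysics.QuantumFieldTheory.BalabanImbrieJaffe1984to88.BIJ88BlockCentredWeight (pow_dvd_sitesPerDir)
open ExpMeanLog (deltaSU)
open Summit.QuantumFields.Balaban3D.Carriers (radialContourData)
open Summit.QuantumFields.YangMills.BalabanUVNodes.N07FineBondByCoarsestFace (dist1_fine_le_of_top)
open Summit.QuantumFields.YangMills.BalabanUVNodes.N07FinePathCrossingCount (dist1_fine_le_layer sum_le_layerCake)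
open Summit.QuantumFields.YangMills.BalabanUVNodes.N07DataDownTheRadialTower (hint_of_radialTower)
open Summit.QuantumFields.YangMills.BalabanUVNodes.N07FineBoxShearVariation (runSite_castSite)

/-! ## §1  Labels versus residues (`Lⁱ ∣ N₀`), and the wrapping bond crosses every face -/

section Labels

variable {P : Params}

/-- ★ **RESIDUE DIVISIBILITY IS LABEL DIVISIBILITY**: for a cover-labelled fine site `castSite z` and `i ≤ m + K`, `Lⁱ ∣ (z_μ mod N₀) + 1 ⇔ (Lⁱ : ℤ) ∣ z_μ + 1` — because `Lⁱ ∣ N₀`.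
[cite: Balaban1987RG1, (0.1)–(0.3) pp.251–252 (bookkeeping)] -/
theorem dvd_val_succ_iff_dvd_label {i : ℕ} (hi : i ≤ P.m + P.K) (z : Fin P.d → ℤ) (μ : Fin P.d) :
    P.L ^ i ∣ ((castSite z : Site P 0) μ).val + 1 ↔ ((P.L ^ i : ℕ) : ℤ) ∣ z μ + 1 := by
  have hN : ((P.L ^ i : ℕ) : ℤ) ∣ ((P.sitesPerDir 0 : ℕ) : ℤ) := Int.natCast_dvd_natCast.mpr (pow_dvd_sitesPerDir hi)
  have hval : ((((castSite z : Site P 0) μ).val : ℕ) : ℤ) = z μ % ((P.sitesPerDir 0 : ℕ) : ℤ) := by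
    rw [T4AxialGaugeSmallField.castSite_apply]
    exact ZMod.val_intCast _
  rw [← Int.natCast_dvd_natCast, Nat.cast_add, Nat.cast_one, hval]
  -- the two integers differ by a multiple of `N₀`
  refine dvd_iff_dvd_of_dvd_sub ?_
  rw [Int.emod_def]
  have e : z μ - ((P.sitesPerDir 0 : ℕ) : ℤ) * (z μ / ((P.sitesPerDir 0 : ℕ) : ℤ)) + 1 - (z μ + 1) =
      ((P.sitesPerDir 0 : ℕ) : ℤ) * (-(z μ / ((P.sitesPerDir 0 : ℕ) : ℤ))) := by ring
  rw [e]
  exact hN.mul_right _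

/-- ★ **THE WRAPPING BOND CROSSES EVERY FACE**: if the near end's residue in the bond's direction is `N₀ − 1` (`val + 1 = N₀`), then the far end's residue is `0`, and at every height
`i ≤ m + K` (including `i = 0`: the two ends) the `i`-fold block points differ (`val_iterBlockOf`: `(N₀ − 1) ∕ Lⁱ ≥ 1` while `0 ∕ Lⁱ = 0`). [cite: Balaban1987RG1, (0.3) p.252; Balaban1984PropagatorsI, (1.6) p.18] -/
theorem iterBlockOf_src_ne_tgt_of_wrap (b : PBond P 0) (hv : (b.src b.dir).val + 1 = P.sitesPerDir 0) {i : ℕ} (hi : i ≤ P.m + P.K) :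
    iterBlockOf i b.src ≠ iterBlockOf i b.tgt := by
  -- the far end's residue is `0`
  have htgt0 : (b.tgt b.dir).val = 0 := by
    have h1 : b.tgt b.dir = b.src b.dir + 1 := by
      rw [PBond.tgt, B10StarCount.shift_apply_self]
    have h2 : b.src b.dir + 1 = 0 := by
      have h3 := ZMod.natCast_zmod_val (b.src b.dir)
      rw [← h3, ← Nat.cast_one, ← Nat.cast_add, hv, ZMod.natCast_self]
    rw [h1, h2, ZMod.val_zero]
  -- `Lⁱ ≤ N₀ − 1`
  have hLi : P.L ^ i ≤ (b.src b.dir).val := by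
    have h1 : P.L ^ i ≤ P.L ^ (P.m + P.K) := Nat.pow_le_pow_right P.L_pos hi
    have h2 : 1 ≤ P.L ^ (P.m + P.K) := Nat.one_le_pow _ _ P.L_pos
    have h3 : P.sitesPerDir 0 = 2 * P.L ^ (P.m + P.K) := by simp [Params.sitesPerDir]
    omega
  intro h
  have h' : ((iterBlockOf i b.src) b.dir).val = ((iterBlockOf i b.tgt) b.dir).val := by rw [h]
  rw [val_iterBlockOf i hi, val_iterBlockOf i hi, htgt0, Nat.zero_div] at h'
  have hpos : 1 ≤ (b.src b.dir).val / P.L ^ i := (Nat.one_le_div_iff (pow_pos P.L_pos i)).mpr hLi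
  omega

end Labels

/-! ## §1b  The per-bond layer bound without the no-wrap hypothesis -/

section Layer

variable {F : T4Continuum.T4Family} {N : ℕ} [NeZero N] {K : ℕ}

/-- ★★ **THE PER-BOND LAYER BOUND, ANY FINE BOND**: dag-n07-w6's `N07FinePathCrossingCount.dist1_fine_le_layer` — `dist1 (U′ b) ≤ Σ_{i ≤ k, i = 0 ∨ Lⁱ ∣ v + 1} θ_i`, `θ_i := τ_i + κ_i`
(`i < k`), `θ_k := v_k` — WITHOUT `hv : v + 1 < N₀`: the non-wrapping bond is their theorem; the wrapping bond (`v + 1 = N₀`) crosses every face (§1), so FILE 7's `dist1_fine_le_of_top` bounds it by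
`v_k + Σ_{i<k} κ_i`, below the full layer sum (every height divides `N₀`). [cite: Balaban1985Variational, (145) p.301; Balaban1985RegularSpaces, Lemma 1 (1.25) p.79; Balaban1987RG1, (0.3) p.252] -/
theorem dist1_fine_le_layer_any {k : ℕ} (hk : k ≤ (F.P K).m + (F.P K).K) (U' : GaugeField (F.P K) 0 (SU N)) (W : ∀ i : ℕ, Set (Site (F.P K) i)) (a τ : ℕ → ℝ) {vk : ℝ}
    (hnest : ∀ i < k, ∀ x : Site (F.P K) i, x ∈ W i → blockOf x ∈ W (i + 1))
    (ha : ∀ i < k, 0 ≤ a i) (hτ : ∀ i < k, 0 ≤ τ i) (hvk : 0 ≤ vk)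
    (ht : ∀ i < k, (((((F.P K).d + 2) * (F.P K).L : ℕ) : ℝ) ^ 2 / 4) * a i < deltaSU (Fin N))
    (hplaq : ∀ i < k, ∀ c : PBond (F.P K) (i + 1), c.src ∈ W (i + 1) → c.tgt ∈ W (i + 1) → ∀ q : Plaq (F.P K) i,
      (blockOf q.src = c.src.unshift c.dir ∨ blockOf q.src = c.src ∨ blockOf q.src = c.tgt) → dist1 (GaugeField.plaqHol (Averaging.iter (avOfRecord F N K) i U') q) < a i)
    (hint : ∀ i < k, ∀ b' : PBond (F.P K) i, blockOf b'.src = blockOf b'.tgt → blockOf b'.src ∈ W (i + 1) → dist1 (Averaging.iter (avOfRecord F N K) i U' b') ≤ τ i)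
    (htop : ∀ c : PBond (F.P K) k, c.src ∈ W k → c.tgt ∈ W k → dist1 (Averaging.iter (avOfRecord F N K) k U' c) ≤ vk)
    (b : PBond (F.P K) 0) (hbs : b.src ∈ W 0) (hbt : b.tgt ∈ W 0) :
    dist1 (U' b) ≤ ∑ i ∈ (Finset.range (k + 1)).filter (fun i => i = 0 ∨ (F.P K).L ^ i ∣ (b.src b.dir).val + 1),
      (if i < k then τ i + (7 * ((((((F.P K).d + 2) * (F.P K).L : ℕ) : ℝ) ^ 2 / 4) * a i) + ((((F.P K).d + 1) * ((F.P K).L - 1) : ℕ) : ℝ) * τ i) else vk) := by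
  classical
  have hle : (b.src b.dir).val + 1 ≤ (F.P K).sitesPerDir 0 := Nat.succ_le_of_lt (ZMod.val_lt _)
  rcases hle.lt_or_eq with hlt | heq
  · exact dist1_fine_le_layer hk U' W a τ hnest ha hτ hvk ht hplaq hint htop b hbs hbt hlt
  · -- the wrapping bond: every height is admitted and the chain reaches the top
    have hall : (Finset.range (k + 1)).filter (fun i => i = 0 ∨ (F.P K).L ^ i ∣ (b.src b.dir).val + 1) = Finset.range (k + 1) := by
      refine Finset.filter_true_of_mem fun i hi => ?_
      rcases Nat.eq_zero_or_pos i with h0 | _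
      · exact Or.inl h0
      · right
        rw [heq]
        exact pow_dvd_sitesPerDir (by have := Finset.mem_range.1 hi; omega)
    rw [hall]
    have hcross : ∀ i < k, iterBlockOf (i + 1) b.src ≠ iterBlockOf (i + 1) b.tgt := fun i hi =>
      iterBlockOf_src_ne_tgt_of_wrap b heq (by omega)
    have hfile7 := dist1_fine_le_of_top U' W a τ b hbs hbt hk hnest ha hτ ht hplaq hint hcross htop
    have hsum : ∑ i ∈ Finset.range k, (7 * ((((((F.P K).d + 2) * (F.P K).L : ℕ) : ℝ) ^ 2 / 4) * a i) + ((((F.P K).d + 1) * ((F.P K).L - 1) : ℕ) : ℝ) * τ i) ≤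
        ∑ i ∈ Finset.range k, (if i < k then τ i + (7 * ((((((F.P K).d + 2) * (F.P K).L : ℕ) : ℝ) ^ 2 / 4) * a i) + ((((F.P K).d + 1) * ((F.P K).L - 1) : ℕ) : ℝ) * τ i) else vk) :=
      Finset.sum_le_sum fun i hi => by
        have hik : i < k := Finset.mem_range.1 hi
        rw [if_pos hik]
        linarith [hτ i hik]
    rw [Finset.sum_range_succ, if_neg (lt_irrefl k)]
    linarith [hfile7, hsum]

end Layer

/-! ## §2  The layer-cake count at an integer anchor -/

section Count

/-- ★ **LAYER-CAKE AT AN INTEGER ANCHOR**: dag-n07-w6's `sum_le_layerCake` with `v₀ ∈ ℤ` and the predicate `(Lⁱ : ℤ) ∣ v₀ + s + 1` — reduced to the natural anchor `v₀ mod Lᵏ ∈ [0, Lᵏ)`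
(`Lⁱ ∣ Lᵏ` for `i ≤ k`, so the two predicates agree at every admitted height). [folklore] -/
theorem sum_le_layerCake_int {L : ℕ} (hL : 1 ≤ L) (k : ℕ) (v₀ : ℤ) (n : ℕ) (θ : ℕ → ℝ) (hθ : ∀ i ≤ k, 0 ≤ θ i) (f : ℕ → ℝ)
    (hf : ∀ s < n, f s ≤ ∑ i ∈ (Finset.range (k + 1)).filter (fun i => i = 0 ∨ ((L ^ i : ℕ) : ℤ) ∣ v₀ + s + 1), θ i) :
    ∑ s ∈ Finset.range n, f s ≤ (n : ℝ) * θ 0 + ∑ i ∈ Finset.range k, (((n / L ^ (i + 1) + 1 : ℕ)) : ℝ) * θ (i + 1) := by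
  classical
  -- the natural anchor
  have hq : (0 : ℤ) < ((L ^ k : ℕ) : ℤ) := by exact_mod_cast pow_pos (by omega : 0 < L) k
  set w : ℕ := (v₀ % ((L ^ k : ℕ) : ℤ)).toNat with hw
  have hw0 : (w : ℤ) = v₀ % ((L ^ k : ℕ) : ℤ) := by
    rw [hw, Int.toNat_of_nonneg (Int.emod_nonneg _ hq.ne')]
  -- the predicates agree at every height `i ≤ k`
  have hiff : ∀ i ≤ k, ∀ s : ℕ, (((L ^ i : ℕ) : ℤ) ∣ v₀ + s + 1) ↔ (L ^ i ∣ w + s + 1) := by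
    intro i hi s
    rw [← Int.natCast_dvd_natCast]
    push_cast
    rw [hw0]
    refine dvd_iff_dvd_of_dvd_sub ?_
    have hik : ((L ^ i : ℕ) : ℤ) ∣ ((L ^ k : ℕ) : ℤ) := Int.natCast_dvd_natCast.mpr (pow_dvd_pow L hi)
    rw [Int.emod_def]
    have e : v₀ + (s : ℤ) + 1 - (v₀ - ((L ^ k : ℕ) : ℤ) * (v₀ / ((L ^ k : ℕ) : ℤ)) + (s : ℤ) + 1) = ((L ^ k : ℕ) : ℤ) * (v₀ / ((L ^ k : ℕ) : ℤ)) := by ring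
    rw [e]
    exact hik.mul_right _
  refine sum_le_layerCake hL k w n θ hθ f fun s hs => (hf s hs).trans (le_of_eq ?_)
  refine Finset.sum_congr (Finset.filter_congr fun i hi => ?_) fun _ _ => rfl
  have hik : i ≤ k := by have := Finset.mem_range.1 hi; omega
  rw [hiff i hik s]

end Count

/-! ## §3  The sum along a cover-labelled straight run -/

section Run

variable {F : T4Continuum.T4Family} {N : ℕ} [NeZero N] {K : ℕ}

/-- The `s`-th bond of the run from `castSite z` in direction `μ`: direction `μ`, near end `castSite (update z μ (z_μ + s))`, so its residue in direction `μ` is `(z_μ + s) mod N₀`.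
[cite: Balaban1984PropagatorsI, (1.7) p.18 (bookkeeping)] -/
theorem runBond_castSite_src (z : Fin (F.P K).d → ℤ) (μ : Fin (F.P K).d) (s : ℕ) :
    (runBond (castSite z : Site (F.P K) 0) μ s).dir = μ ∧
      (runBond (castSite z : Site (F.P K) 0) μ s).src = castSite (Function.update z μ (z μ + s)) :=
  ⟨rfl, by
    show runSite (castSite z) μ s = _
    exact runSite_castSite z μ s⟩

/-- ★★★ **THE SUM ALONG A COVER-LABELLED STRAIGHT RUN, VAL-FREE**: in the setting of dag-n07-w6's `sum_dist1_fine_path_le` (any `U′`, windows nested under blocking up to the top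
`1 ≤ k ≤ m + K`, per-level letters `a_i, τ_i ≥ 0` with `((d+2)L)²∕4·a_i < δ_N`, plaquette ∕ within-block hypotheses over the windows, top letter `v_k`), for the run `s ↦ runBond (castSite z) μ s`,
`s < n`, with both ends of every bond in the bottom window: `Σ_{s<n} dist1 (U′ (runBond (castSite z) μ s)) ≤ n·θ₀ + Σ_{i<k} (n ∕ L^{i+1} + 1)·θ_{i+1}` — NO `hval`, NO `hwrap`.
[cite: Balaban1985Variational, (145) p.301; Balaban1985RegularSpaces, Lemma 1 (1.25) p.79; Balaban1987RG1, (0.1)–(0.3) pp.251–252] -/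
theorem sum_dist1_run_le {k : ℕ} (hk1 : 1 ≤ k) (hk : k ≤ (F.P K).m + (F.P K).K) (U' : GaugeField (F.P K) 0 (SU N)) (W : ∀ i : ℕ, Set (Site (F.P K) i)) (a τ : ℕ → ℝ) {vk : ℝ}
    (hnest : ∀ i < k, ∀ x : Site (F.P K) i, x ∈ W i → blockOf x ∈ W (i + 1))
    (ha : ∀ i < k, 0 ≤ a i) (hτ : ∀ i < k, 0 ≤ τ i) (hvk : 0 ≤ vk)
    (ht : ∀ i < k, (((((F.P K).d + 2) * (F.P K).L : ℕ) : ℝ) ^ 2 / 4) * a i < deltaSU (Fin N))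
    (hplaq : ∀ i < k, ∀ c : PBond (F.P K) (i + 1), c.src ∈ W (i + 1) → c.tgt ∈ W (i + 1) → ∀ q : Plaq (F.P K) i,
      (blockOf q.src = c.src.unshift c.dir ∨ blockOf q.src = c.src ∨ blockOf q.src = c.tgt) → dist1 (GaugeField.plaqHol (Averaging.iter (avOfRecord F N K) i U') q) < a i)
    (hint : ∀ i < k, ∀ b' : PBond (F.P K) i, blockOf b'.src = blockOf b'.tgt → blockOf b'.src ∈ W (i + 1) → dist1 (Averaging.iter (avOfRecord F N K) i U' b') ≤ τ i)
    (htop : ∀ c : PBond (F.P K) k, c.src ∈ W k → c.tgt ∈ W k → dist1 (Averaging.iter (avOfRecord F N K) k U' c) ≤ vk)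
    (z : Fin (F.P K).d → ℤ) (μ : Fin (F.P K).d) (n : ℕ)
    (hbW : ∀ s < n, (runBond (castSite z : Site (F.P K) 0) μ s).src ∈ W 0 ∧ (runBond (castSite z : Site (F.P K) 0) μ s).tgt ∈ W 0) :
    ∑ s ∈ Finset.range n, dist1 (U' (runBond (castSite z : Site (F.P K) 0) μ s)) ≤
      (n : ℝ) * (τ 0 + (7 * ((((((F.P K).d + 2) * (F.P K).L : ℕ) : ℝ) ^ 2 / 4) * a 0) + ((((F.P K).d + 1) * ((F.P K).L - 1) : ℕ) : ℝ) * τ 0)) +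
        ∑ i ∈ Finset.range k, (((n / (F.P K).L ^ (i + 1) + 1 : ℕ)) : ℝ) *
          (if i + 1 < k then τ (i + 1) + (7 * ((((((F.P K).d + 2) * (F.P K).L : ℕ) : ℝ) ^ 2 / 4) * a (i + 1)) + ((((F.P K).d + 1) * ((F.P K).L - 1) : ℕ) : ℝ) * τ (i + 1))
            else vk) := by
  classical
  set θ : ℕ → ℝ := fun i => if i < k then τ i + (7 * ((((((F.P K).d + 2) * (F.P K).L : ℕ) : ℝ) ^ 2 / 4) * a i) + ((((F.P K).d + 1) * ((F.P K).L - 1) : ℕ) : ℝ) * τ i) else vk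
    with hθdef
  have hθ : ∀ i ≤ k, 0 ≤ θ i := by
    intro i hi
    simp only [hθdef]
    split_ifs with hik
    · have := ha i hik; have := hτ i hik; positivity
    · exact hvk
  have hmain := sum_le_layerCake_int (F.P K).L_pos k (z μ) n θ hθ (fun s => dist1 (U' (runBond (castSite z : Site (F.P K) 0) μ s))) (fun s hs => by
    have hb := hbW s hs
    have h := dist1_fine_le_layer_any hk U' W a τ hnest ha hτ hvk ht hplaq hint htop _ hb.1 hb.2
    obtain ⟨hdir, hsrc⟩ := runBond_castSite_src (F := F) (K := K) z μ s
    rw [hdir, hsrc] at h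
    refine h.trans (le_of_eq (Finset.sum_congr (Finset.filter_congr fun i hi => ?_) fun _ _ => rfl))
    have hik : i ≤ (F.P K).m + (F.P K).K := by have := Finset.mem_range.1 hi; omega
    rw [dvd_val_succ_iff_dvd_label hik, Function.update_self])
  have hθ0 : θ 0 = τ 0 + (7 * ((((((F.P K).d + 2) * (F.P K).L : ℕ) : ℝ) ^ 2 / 4) * a 0) + ((((F.P K).d + 1) * ((F.P K).L - 1) : ℕ) : ℝ) * τ 0) := by
    simp only [hθdef, if_pos (show 0 < k by omega)]
  rw [hθ0] at hmain
  exact hmain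

/-- ★★★ **THE SAME AT A RADIAL-TOWER REPRESENTATIVE, within-block letters SUPPLIED** (dag-n07-w6's `N07DataDownTheRadialTower.sum_dist1_fine_path_radialTower_le`, val-free): the averages
`Mⁱ U′`, `i < k`, carry the RADIAL axial gauge; `τ_i := (d(L−1)+1)·((d−1)(L−1)·a_i)` from the level-`i` plaquette letters of `Mⁱ U′` based in the blocks of the level-`(i+1)` window
(`hint_of_radialTower`); displayed: per-level plaquette letters (both shapes), the top letter on the top window, windows nested under blocking, the run.
[cite: Balaban1985Variational, (145) p.301; Balaban1985RegularSpaces, (1.15) p.78, Lemma 1 (1.25) p.79] -/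
theorem sum_dist1_run_radialTower_le {k : ℕ} (hk1 : 1 ≤ k) (hk : k ≤ (F.P K).m + (F.P K).K) (U' : GaugeField (F.P K) 0 (SU N))
    (hax : ∀ i < k, AxialGauge (radialContourData (F.P K) i (SU N)) (Averaging.iter (avOfRecord F N K) i U'))
    (W : ∀ i : ℕ, Set (Site (F.P K) i)) (a : ℕ → ℝ) {vk : ℝ}
    (hnest : ∀ i < k, ∀ x : Site (F.P K) i, x ∈ W i → blockOf x ∈ W (i + 1))
    (ha : ∀ i < k, 0 ≤ a i) (hvk : 0 ≤ vk)
    (ht : ∀ i < k, (((((F.P K).d + 2) * (F.P K).L : ℕ) : ℝ) ^ 2 / 4) * a i < deltaSU (Fin N))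
    (hplaq : ∀ i < k, ∀ c : PBond (F.P K) (i + 1), c.src ∈ W (i + 1) → c.tgt ∈ W (i + 1) → ∀ q : Plaq (F.P K) i,
      (blockOf q.src = c.src.unshift c.dir ∨ blockOf q.src = c.src ∨ blockOf q.src = c.tgt) → dist1 (GaugeField.plaqHol (Averaging.iter (avOfRecord F N K) i U') q) < a i)
    (hplaqB : ∀ i < k, ∀ y : Site (F.P K) (i + 1), y ∈ W (i + 1) → ∀ q : Plaq (F.P K) i, blockOf q.src = y →
      dist1 (GaugeField.plaqHol (Averaging.iter (avOfRecord F N K) i U') q) < a i)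
    (htop : ∀ c : PBond (F.P K) k, c.src ∈ W k → c.tgt ∈ W k → dist1 (Averaging.iter (avOfRecord F N K) k U' c) ≤ vk)
    (z : Fin (F.P K).d → ℤ) (μ : Fin (F.P K).d) (n : ℕ)
    (hbW : ∀ s < n, (runBond (castSite z : Site (F.P K) 0) μ s).src ∈ W 0 ∧ (runBond (castSite z : Site (F.P K) 0) μ s).tgt ∈ W 0) :
    ∑ s ∈ Finset.range n, dist1 (U' (runBond (castSite z : Site (F.P K) 0) μ s)) ≤
      (n : ℝ) * (((((F.P K).d * ((F.P K).L - 1) + 1 : ℕ) : ℝ) * (((((F.P K).d - 1 : ℕ) : ℝ) * (((F.P K).L - 1 : ℕ) : ℝ)) * a 0)) +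
          (7 * ((((((F.P K).d + 2) * (F.P K).L : ℕ) : ℝ) ^ 2 / 4) * a 0) +
            ((((F.P K).d + 1) * ((F.P K).L - 1) : ℕ) : ℝ) * ((((F.P K).d * ((F.P K).L - 1) + 1 : ℕ) : ℝ) * (((((F.P K).d - 1 : ℕ) : ℝ) * (((F.P K).L - 1 : ℕ) : ℝ)) * a 0)))) +
        ∑ i ∈ Finset.range k, (((n / (F.P K).L ^ (i + 1) + 1 : ℕ)) : ℝ) *
          (if i + 1 < k then
              ((((F.P K).d * ((F.P K).L - 1) + 1 : ℕ) : ℝ) * (((((F.P K).d - 1 : ℕ) : ℝ) * (((F.P K).L - 1 : ℕ) : ℝ)) * a (i + 1))) +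
                (7 * ((((((F.P K).d + 2) * (F.P K).L : ℕ) : ℝ) ^ 2 / 4) * a (i + 1)) +
                  ((((F.P K).d + 1) * ((F.P K).L - 1) : ℕ) : ℝ) * ((((F.P K).d * ((F.P K).L - 1) + 1 : ℕ) : ℝ) * (((((F.P K).d - 1 : ℕ) : ℝ) * (((F.P K).L - 1 : ℕ) : ℝ)) * a (i + 1))))
            else vk) := by
  have hτ : ∀ j < k, (0 : ℝ) ≤ ((((F.P K).d * ((F.P K).L - 1) + 1 : ℕ) : ℝ) * (((((F.P K).d - 1 : ℕ) : ℝ) * (((F.P K).L - 1 : ℕ) : ℝ)) * a j)) := fun j hj => by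
    have := ha j hj; positivity
  exact sum_dist1_run_le hk1 hk U' W a _ hnest ha hτ hvk ht hplaq (hint_of_radialTower hk U' hax W a ha hplaqB) htop z μ n hbW

/-- A6 NON-VACUITY: at the trivial representative `U′ = 1` the hypotheses of `sum_dist1_run_le` hold on ANY windows with `τ = 0`, `v_k = 0` and any plaquette letter `a₀ > 0` below the
[6] Lemma 1 threshold (`Mⁱ(1) = 1`: lit `B15Claim189UnitTestAtRecord.iter_avOfRecord_one`; dag-n07-w6 `N07DataDownTheTower.plaq_down_the_tower_one`), and the conclusion bounds `Σ_{s<n} dist1 1 = 0`.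
[cite: Balaban1985Variational, (145) p.301 (bookkeeping)] -/
theorem sum_dist1_run_le_one {k : ℕ} (hk1 : 1 ≤ k) (hk : k ≤ (F.P K).m + (F.P K).K) (W : ∀ i : ℕ, Set (Site (F.P K) i))
    (hnest : ∀ i < k, ∀ x : Site (F.P K) i, x ∈ W i → blockOf x ∈ W (i + 1)) {a₀ : ℝ} (ha₀ : 0 < a₀)
    (hta : (((((F.P K).d + 2) * (F.P K).L : ℕ) : ℝ) ^ 2 / 4) * a₀ < deltaSU (Fin N))
    (z : Fin (F.P K).d → ℤ) (μ : Fin (F.P K).d) (n : ℕ)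
    (hbW : ∀ s < n, (runBond (castSite z : Site (F.P K) 0) μ s).src ∈ W 0 ∧ (runBond (castSite z : Site (F.P K) 0) μ s).tgt ∈ W 0) :
    ∑ s ∈ Finset.range n, dist1 ((1 : GaugeField (F.P K) 0 (SU N)) (runBond (castSite z : Site (F.P K) 0) μ s)) ≤
      (n : ℝ) * ((0 : ℝ) + (7 * ((((((F.P K).d + 2) * (F.P K).L : ℕ) : ℝ) ^ 2 / 4) * a₀) + ((((F.P K).d + 1) * ((F.P K).L - 1) : ℕ) : ℝ) * (0 : ℝ))) +
        ∑ i ∈ Finset.range k, (((n / (F.P K).L ^ (i + 1) + 1 : ℕ)) : ℝ) *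
          (if i + 1 < k then (0 : ℝ) + (7 * ((((((F.P K).d + 2) * (F.P K).L : ℕ) : ℝ) ^ 2 / 4) * a₀) + ((((F.P K).d + 1) * ((F.P K).L - 1) : ℕ) : ℝ) * (0 : ℝ)) else (0 : ℝ)) := by
  refine sum_dist1_run_le hk1 hk (1 : GaugeField (F.P K) 0 (SU N)) W (fun _ => a₀) (fun _ => 0) hnest (fun _ _ => ha₀.le) (fun _ _ => le_rfl) le_rfl
    (fun _ _ => hta) (fun i _ c _ _ q _ => ?_) (fun i _ b' _ _ => ?_) (fun c _ _ => ?_) z μ n hbW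
  · exact N07DataDownTheTower.plaq_down_the_tower_one F N K i ha₀ q
  · rw [B15Claim189UnitTestAtRecord.iter_avOfRecord_one F N K i]; exact le_of_eq GaugeGroup.dist1_one
  · rw [B15Claim189UnitTestAtRecord.iter_avOfRecord_one F N K k]; exact le_of_eq GaugeGroup.dist1_one

end Run

end Summit.QuantumFields.YangMills.BalabanUVNodes.N07FinePathSumLabelled

end
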